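import Literature.Computability.Cryptography.LWEPrimePowerProgQuery
import Literature.Computability.Cryptography.LWEPrimePowerProgOut
import HarnessLib

/-!
# The Micciancio–Peikert machine, VIII: the query and output functions of the machine on strings

Topic `Computability/Cryptography` (LWE), grouping namespace `LWE.MP12.Prog`, sequel of
`LWEPrimePowerProgQuery.lean` and `LWEPrimePowerProgOut.lean`. Proved material (no named fact) towards
`Literature.Computability.Cryptography.blprs_gapSVP_sqrt_dim_to_lwe_classical` (**pqc.S21**),
hypothesis `h₂`: the two string functions of the adaptive oracle machine
(`Complexity/AdaptiveFunctions.adFnAlg`): on `⟨⟨⟨1ⁿ, samples⟩, coins⟩, answers⟩` the QUERY function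
computes the schedule from `1ⁿ`, the unary copies (capped by the input length), the query of the round
and the code `⟨⟨1ⁿ, block⟩, the call's coins⟩` of the distinguisher's input with its random tape
(`topQ`, **`codeFP_topQ`**); the OUTPUT function computes the code of the secret (`topG`,
**`codeFP_topG`**). Both are ONE polynomial-time string function for all `n`.

## References

* D. Micciancio, C. Peikert, *Trapdoors for lattices: simpler, tighter, faster, smaller*, EUROCRYPT 2012,
  LNCS 7237; full version IACR ePrint 2011/501, §3, Thm. 3.1 proof (pp. 15–16). [MicciancioPeikert2012]
* S. Arora, B. Barak, *Computational Complexity: A Modern Approach*, CUP 2009, §1.3, §3.4. [AroraBarak2009]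
-/

namespace Literature.Computability.Cryptography

namespace LWE

namespace MP12

namespace Prog

open _root_.Computability Polynomial Literature.Computability.Complexity Literature.Computability.Complexity.CodeFP

/-- The machine's round input `(((n, samples), coins), answers)`. [folklore] -/
abbrev TopIn : Type := ((ℕ × LData) × List Bool) × List Bool

/-- Its code `⟨⟨⟨1ⁿ, encodeLWESamples⟩, coins⟩, answers⟩`. [cite: RegevLWE2009, §2 (input format)] -/
abbrev topE : TopIn → List Bool := pairE (pairE (pairE unE ldataE) strE) strE

/-- The code of the round input, as a string (for its length). [folklore] -/
theorem codeFP_topSelf : CodeFP topE strE (fun z => topE z) := ⟨_root_.id, PolyTimeComputable.id _, fun _ => rfl⟩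

section Top

variable (c : ℕ) (m₂ : ℕ → ℕ) (coinsD : Polynomial ℕ)

/-- A unary copy capped by the input length. [folklore] -/
def ucap (z : TopIn) (v : ℕ) : ℕ := min v (topE z).length

/-- **The unary copies** `(1ᵈ, (1ᴷ, (1ᵉ, (1ᵐ, (1ᵀ, (1ᴺ, 1ᴺ'))))))` of the schedule, capped by the input length. [folklore] -/
def unaryOf (z : TopIn) : UnT :=
  let P : PrmT := prmOf c m₂ coinsD z.1.1.1
  (ucap z P.d, (ucap z P.K, (ucap z P.e, (ucap z P.m, (ucap z P.T, (ucap z P.N, ucap z P.N'))))))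

variable {m₂}

/-- `unaryOf` on codes. [cite: AroraBarak2009, §1.3] -/
theorem codeFP_unaryOf (hm₂ : CodeFP unE natE m₂) : CodeFP topE unTE (unaryOf c m₂ coinsD) := by
  have hn := (fst (pairE (pairE unE ldataE) strE) strE).fst'.fst'
  have hP := (codeFP_prmOf c coinsD hm₂).comp hn
  have hlen := strLength.comp codeFP_topSelf
  have hu := fun {g : TopIn → ℕ} (hg : CodeFP topE natE g) => unOfNatMin.comp (hlen.pair hg)
  exact ((hu (codeFP_prm_d.comp hP)).pair ((hu (codeFP_prm_K.comp hP)).pair ((hu (codeFP_prm_e.comp hP)).pair ((hu (codeFP_prm_m.comp hP)).pair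
    ((hu (codeFP_prm_T.comp hP)).pair ((hu (codeFP_prm_N.comp hP)).pair (hu (codeFP_prm_N'.comp hP)))))))).congr fun z => by
    obtain ⟨⟨⟨n, LD⟩, r⟩, bits⟩ := z; rfl

variable (m₂)

/-- **The query function of the machine**: `⟨⟨1ⁿ, block of the round⟩, the call's coins (as many as the
distinguisher's tape)⟩`. [cite: MicciancioPeikert2012, Thm. 3.1 proof (pp. 15–16)] -/
noncomputable def topQ (z : TopIn) : (ℕ × LData) × List Bool :=
  let n := z.1.1.1
  let P : PrmT := prmOf c m₂ coinsD n
  let q := queryOfL ((P, unaryOf c m₂ coinsD z), (z.1.1.2.2.2, (z.1.2, z.2)))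
  ((n, q.1), q.2.take (min (coinsD.eval (pairE unE ldataE (n, q.1)).length) q.2.length))

/-- **The output function of the machine**: the code of the secret. [cite: MicciancioPeikert2012, Thm. 3.1 proof (p. 16)] -/
noncomputable def topG (z : TopIn) : List ℕ × List Bool :=
  outOfL ((prmOf c m₂ coinsD z.1.1.1, unaryOf c m₂ coinsD z), (z.1.1.2.2.2, z.2))

variable {m₂}

/-- **The query function on codes.** [cite: AroraBarak2009, §1.3, §3.4] -/
theorem codeFP_topQ (hm₂ : CodeFP unE natE m₂) : CodeFP topE (pairE (pairE unE ldataE) strE) (topQ c m₂ coinsD) := by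
  have hn := (fst (pairE (pairE unE ldataE) strE) strE).fst'.fst'
  have hLD := (fst (pairE (pairE unE ldataE) strE) strE).fst'.snd'
  have hr := (fst (pairE (pairE unE ldataE) strE) strE).snd'
  have hbits := snd (pairE (pairE unE ldataE) strE) strE
  have hP := (codeFP_prmOf c coinsD hm₂).comp hn
  have hitems := (rawOfList itemE).comp hLD.snd'.snd'
  have hq := codeFP_queryOfL.comp ((hP.pair (codeFP_unaryOf c coinsD hm₂)).pair (hitems.pair (hr.pair hbits)))
  have hx := hn.pair hq.fst'
  have hxStr := hx.recodeOut (eγ := strE) (g' := fun z => pairE unE ldataE (z.1.1.1, (queryOfL ((prmOf c m₂ coinsD z.1.1.1, unaryOf c m₂ coinsD z), (z.1.1.2.2.2, (z.1.2, z.2)))).1))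
    fun _ => rfl
  have hk := (codeFP_polyEval coinsD).comp (strNatLength.comp hxStr)
  have hcs := hq.snd'
  have htake := strTake.comp ((unOfNatMin.comp ((strLength.comp hcs).pair hk)).pair hcs)
  exact (hx.pair htake).congr fun z => by obtain ⟨⟨⟨n, LD⟩, r⟩, bits⟩ := z; rfl

/-- **The output function on codes.** [cite: AroraBarak2009, §1.3, §3.4] -/
theorem codeFP_topG (hm₂ : CodeFP unE natE m₂) : CodeFP topE (pairE (listE natE) strE) (topG c m₂ coinsD) := by
  have hn := (fst (pairE (pairE unE ldataE) strE) strE).fst'.fst'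
  have hLD := (fst (pairE (pairE unE ldataE) strE) strE).fst'.snd'
  have hbits := snd (pairE (pairE unE ldataE) strE) strE
  have hP := (codeFP_prmOf c coinsD hm₂).comp hn
  have hitems := (rawOfList itemE).comp hLD.snd'.snd'
  exact (codeFP_outOfL.comp ((hP.pair (codeFP_unaryOf c coinsD hm₂)).pair (hitems.pair hbits))).congr fun z => by
    obtain ⟨⟨⟨n, LD⟩, r⟩, bits⟩ := z; rfl

/-! ### The string functions -/

/-- **The query function as a string map** (a witness of `codeFP_topQ`). [cite: AroraBarak2009, §3.4] -/
noncomputable def topQS (hm₂ : CodeFP unE natE m₂) : List Bool → List Bool := Classical.choose (codeFP_topQ c coinsD hm₂)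

/-- It is polynomial time. [cite: AroraBarak2009, §3.4] -/
theorem topQS_mem_FP (hm₂ : CodeFP unE natE m₂) : topQS c coinsD hm₂ ∈ FP := (Classical.choose_spec (codeFP_topQ c coinsD hm₂)).1

/-- It computes `topQ` on codes. [cite: AroraBarak2009, §3.4] -/
theorem topQS_apply (hm₂ : CodeFP unE natE m₂) (z : TopIn) : topQS c coinsD hm₂ (topE z) = pairE (pairE unE ldataE) strE (topQ c m₂ coinsD z) :=
  (Classical.choose_spec (codeFP_topQ c coinsD hm₂)).2 z

/-- **The output function as a string map** (a witness of `codeFP_topG`). [cite: AroraBarak2009, §3.4] -/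
noncomputable def topGS (hm₂ : CodeFP unE natE m₂) : List Bool → List Bool := Classical.choose (codeFP_topG c coinsD hm₂)

/-- It is polynomial time. [cite: AroraBarak2009, §3.4] -/
theorem topGS_mem_FP (hm₂ : CodeFP unE natE m₂) : topGS c coinsD hm₂ ∈ FP := (Classical.choose_spec (codeFP_topG c coinsD hm₂)).1

/-- It computes `topG` on codes. [cite: AroraBarak2009, §3.4] -/
theorem topGS_apply (hm₂ : CodeFP unE natE m₂) (z : TopIn) : topGS c coinsD hm₂ (topE z) = pairE (listE natE) strE (topG c m₂ coinsD z) :=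
  (Classical.choose_spec (codeFP_topG c coinsD hm₂)).2 z

end Top

end Prog

end MP12

end LWE

end Literature.Computability.Cryptography
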